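import Summits.ABC.ABC.Theorems.EisensteinQuarantine.Negative.EisensteinQuarantineRefutationFloor
import Summits.ABC.ABC.Theorems.EisensteinQuarantine.Negative.EisensteinQuarantineFalseOfEtaTwoDepthLaw
import HarnessLib

/-!
# Strategist sketch for crux stmt-ABC-15023 `EisensteinQuarantine` (STRATEGY-CENSUS companion; planner-cstrat-stmt-ABC-15023-p1-0)

Typed objects referred to by `STRATEGY-CENSUS.md` (no `sorry`):

* §1 DECOMPOSITION lens: the `p`-adic halves `AdicHalf p` of the crux and the PROVED glue
  `eisensteinQuarantine_of_halves : AdicHalf 2 → AdicHalf 3 → EisensteinQuarantine`.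
* §2 RE-SEAM schema (for the planner of record / human): with an ARBITRARY allowance `D ≥ 1`,
  `QuarantineWith D ∧ CoreWith D → XiStrongBound` is pure algebra (PROVED: `xiStrongBound_of_with`),
  so re-seaming the A/B split of route DefiniteXi costs nothing in typing; the only decision is the
  choice of `D` (and the bet that `CoreWith D` is abc-implied, which holds iff `sixPart ξ ≳ D` — a depth
  LOWER bound — on abc-extremal data).
* §3 STRENGTHEN lens (negation side): the slope-`1/θ` weak forced-pair depth law `WeakForcedPairDepthLaw θ`
  (`θ = 1` is the tree's `ForcedPairDepthLaw`); any `θ ≥ 1` still refutes the crux (the Linnik exponent absorbs `θ`).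
-/

set_option linter.dupNamespace false

noncomputable section

namespace Summit.ABC.ABC.Cruxes.EisensteinQuarantine.Strategist

open scoped BigOperators
open Literature.NumberTheory.Automorphic Literature.NumberTheory.EllipticCurves
open Summit.ABC.ABC.Theses.DefiniteXi
open Summit.ABC.ABC.Theorems.EisensteinQuarantine.Negative

/-! ## §1 The adic halves and their glue -/

/-- The `p`-adic half of the crux: `ordProj[p] ξ ≤ C_ε N^ε · ordProj[p] 𝓛` on the crux's whole domain
(`p = 2, 3`; the dead line `Sketch` typed the equivalent occurrence bounds, calibration p97646). [folklore] -/
def AdicHalf (p : ℕ) : Prop :=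
  ∀ ε : ℝ, 0 < ε → ∃ C : ℝ, ∀ a b : ℤ, IsCoprime a b → a * b * (a + b) ≠ 0 → ∀ (N : ℕ) [NeZero N],
    (freyCurve a b).conductorNorm ℤ = N → ∀ Nm : ℕ, Odd Nm → Squarefree Nm → Odd Nm.primeFactors.card → Nm ∣ N →
      ((ordProj[p] (brandtXi (N / Nm) Nm (fun n => (freyCurve a b).LFunction n)) : ℕ) : ℝ) ≤
        C * (N : ℝ) ^ ε *
          ((ordProj[p] (∏ q ∈ N.primeFactors \ Nm.primeFactors,
              ((freyCurve a b).minimalDiscriminantNorm ℤ).factorization q) : ℕ) : ℝ)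

/-- **Glue of the decomposition** `AdicHalf 2 ∧ AdicHalf 3 ⟹ EisensteinQuarantine` (pure algebra:
`ordProj[2] 𝓛 · ordProj[3] 𝓛 ∣ 𝓛` and `𝓛 ≥ 1` on the domain, `one_le_allowance`). [folklore] -/
theorem eisensteinQuarantine_of_halves (h2 : AdicHalf 2) (h3 : AdicHalf 3) :
    Summit.ABC.ABC.Theses.DefiniteXi.EisensteinQuarantine := by
  intro ε hε
  obtain ⟨C₂, hC₂⟩ := h2 (ε / 2) (by linarith)
  obtain ⟨C₃, hC₃⟩ := h3 (ε / 2) (by linarith)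
  refine ⟨max C₂ 0 * max C₃ 0, ?_⟩
  intro a b hab h0 N _ hN Nm hodd hsq hcard hdvd
  have hA := hC₂ a b hab h0 N hN Nm hodd hsq hcard hdvd
  have hB := hC₃ a b hab h0 N hN Nm hodd hsq hcard hdvd
  set ξ : ℕ := brandtXi (N / Nm) Nm (fun n => (freyCurve a b).LFunction n) with hξ
  set L : ℕ := ∏ q ∈ N.primeFactors \ Nm.primeFactors,
      ((freyCurve a b).minimalDiscriminantNorm ℤ).factorization q with hL
  have hLpos : 0 < L := one_le_allowance h0 hN _
  have hNpos : (0 : ℝ) < (N : ℝ) := by exact_mod_cast Nat.pos_of_ne_zero (NeZero.ne N)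
  have hdvd' : ordProj[2] L * ordProj[3] L ∣ L :=
    Nat.Coprime.mul_dvd_of_dvd_of_dvd (Nat.Coprime.pow _ _ (by norm_num : Nat.Coprime 2 3))
      (Nat.ordProj_dvd L 2) (Nat.ordProj_dvd L 3)
  have hPL : ((ordProj[2] L : ℕ) : ℝ) * ((ordProj[3] L : ℕ) : ℝ) ≤ (L : ℝ) := by
    have := Nat.le_of_dvd hLpos hdvd'
    exact_mod_cast this
  have hA' : ((ordProj[2] ξ : ℕ) : ℝ) ≤ max C₂ 0 * (N : ℝ) ^ (ε / 2) * ((ordProj[2] L : ℕ) : ℝ) := by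
    refine le_trans hA ?_
    gcongr
    exact le_max_left _ _
  have hB' : ((ordProj[3] ξ : ℕ) : ℝ) ≤ max C₃ 0 * (N : ℝ) ^ (ε / 2) * ((ordProj[3] L : ℕ) : ℝ) := by
    refine le_trans hB ?_
    gcongr
    exact le_max_left _ _
  have hN2 : (N : ℝ) ^ (ε / 2) * (N : ℝ) ^ (ε / 2) = (N : ℝ) ^ ε := by
    rw [← Real.rpow_add hNpos]; ring_nf
  have h0A : (0 : ℝ) ≤ ((ordProj[2] ξ : ℕ) : ℝ) := by positivity
  have h0B : (0 : ℝ) ≤ ((ordProj[3] ξ : ℕ) : ℝ) := by positivity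
  have hcoef : (0 : ℝ) ≤ max C₂ 0 * max C₃ 0 * (N : ℝ) ^ ε := by positivity
  calc ((ordProj[2] ξ * ordProj[3] ξ : ℕ) : ℝ)
      = ((ordProj[2] ξ : ℕ) : ℝ) * ((ordProj[3] ξ : ℕ) : ℝ) := by push_cast; ring
    _ ≤ (max C₂ 0 * (N : ℝ) ^ (ε / 2) * ((ordProj[2] L : ℕ) : ℝ)) *
          (max C₃ 0 * (N : ℝ) ^ (ε / 2) * ((ordProj[3] L : ℕ) : ℝ)) :=
        mul_le_mul hA' hB' h0B (le_trans h0A hA')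
    _ = max C₂ 0 * max C₃ 0 * ((N : ℝ) ^ (ε / 2) * (N : ℝ) ^ (ε / 2)) *
          (((ordProj[2] L : ℕ) : ℝ) * ((ordProj[3] L : ℕ) : ℝ)) := by ring
    _ = max C₂ 0 * max C₃ 0 * (N : ℝ) ^ ε *
          (((ordProj[2] L : ℕ) : ℝ) * ((ordProj[3] L : ℕ) : ℝ)) := by rw [hN2]
    _ ≤ max C₂ 0 * max C₃ 0 * (N : ℝ) ^ ε * (L : ℝ) :=
        mul_le_mul_of_nonneg_left hPL hcoef

/-! ## §2 The re-seam schema: an arbitrary allowance `D` -/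

/-- A-side with allowance `D(a,b,N,Nm)` (a natural number; `D = 𝓛` is the crux as filed, `D = 𝓛·∏ sixPart(q²−1)`
is cdisprove's sign-blind C″, a residuacity-charged `D` is the cards' C⁗ / `forcedDepthAllowance`). [folklore] -/
def QuarantineWith (D : ℤ → ℤ → ℕ → ℕ → ℕ) : Prop :=
  ∀ ε : ℝ, 0 < ε → ∃ C : ℝ, ∀ a b : ℤ, IsCoprime a b → a * b * (a + b) ≠ 0 → ∀ (N : ℕ) [NeZero N],
    (freyCurve a b).conductorNorm ℤ = N → ∀ Nm : ℕ, Odd Nm → Squarefree Nm → Odd Nm.primeFactors.card → Nm ∣ N →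
      ((ordProj[2] (brandtXi (N / Nm) Nm (fun n => (freyCurve a b).LFunction n)) *
          ordProj[3] (brandtXi (N / Nm) Nm (fun n => (freyCurve a b).LFunction n)) : ℕ) : ℝ) ≤
        C * (N : ℝ) ^ ε * (D a b N Nm : ℝ)

/-- B-side with the same `D` moved to the left (abc-implied iff `sixPart ξ ≥ D · N^{−o(1)}` on the data where
`ξ·∏ v_q` is abc-extremal — i.e. iff the matching depth LOWER bound holds). [folklore] -/
def CoreWith (D : ℤ → ℤ → ℕ → ℕ → ℕ) : Prop :=
  ∀ ε : ℝ, 0 < ε → ∃ C : ℝ, ∀ a b : ℤ, IsCoprime a b → a * b * (a + b) ≠ 0 → ∀ (N : ℕ) [NeZero N],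
    (freyCurve a b).conductorNorm ℤ = N → ∀ Nm : ℕ, Odd Nm → Squarefree Nm → Odd Nm.primeFactors.card → Nm ∣ N →
      ((brandtXi (N / Nm) Nm (fun n => (freyCurve a b).LFunction n) /
          (ordProj[2] (brandtXi (N / Nm) Nm (fun n => (freyCurve a b).LFunction n)) *
            ordProj[3] (brandtXi (N / Nm) Nm (fun n => (freyCurve a b).LFunction n))) : ℕ) : ℝ) *
        ((∏ q ∈ N.primeFactors, ((freyCurve a b).minimalDiscriminantNorm ℤ).factorization q : ℕ) : ℝ) *
        (D a b N Nm : ℝ) ≤ C * (N : ℝ) ^ (2 + ε)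

/-- **Re-seam glue (PROVED)**: for ANY allowance `D ≥ 1` on admissible data,
`QuarantineWith D → CoreWith D → XiStrongBound`.  Pure algebra as in the route's `closes`:
`ξ = sixPart ξ · coprimeSixPart ξ`, `∏_{q∣Nm} v_q ≤ ∏_{q∣N} v_q` (every `v_q ≥ 1`), then cancel `D`. [folklore] -/
theorem xiStrongBound_of_with (D : ℤ → ℤ → ℕ → ℕ → ℕ)
    (hD : ∀ a b : ℤ, ∀ N Nm : ℕ, 1 ≤ D a b N Nm)
    (hA : QuarantineWith D) (hB : CoreWith D) : XiStrongBound := by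
  intro ε hε
  obtain ⟨C₁, hC₁⟩ := hA (ε / 2) (by linarith)
  obtain ⟨C₂, hC₂⟩ := hB (ε / 2) (by linarith)
  refine ⟨max C₁ 0 * max C₂ 0, ?_⟩
  intro a b hab h0 N _ hN Nm hodd hsq hcard hdvd
  have hA' := hC₁ a b hab h0 N hN Nm hodd hsq hcard hdvd
  have hB' := hC₂ a b hab h0 N hN Nm hodd hsq hcard hdvd
  set ξ : ℕ := brandtXi (N / Nm) Nm (fun n => (freyCurve a b).LFunction n) with hξ
  set s : ℕ := ordProj[2] ξ * ordProj[3] ξ with hs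
  set v : ℕ → ℕ := fun q => ((freyCurve a b).minimalDiscriminantNorm ℤ).factorization q with hv
  set d : ℕ := D a b N Nm with hd
  have hNpos : (0 : ℝ) < (N : ℝ) := by exact_mod_cast Nat.pos_of_ne_zero (NeZero.ne N)
  have hsub : Nm.primeFactors ⊆ N.primeFactors := Nat.primeFactors_mono hdvd (NeZero.ne N)
  have hdpos : (0 : ℝ) < (d : ℝ) := by exact_mod_cast hD a b N Nm
  -- ξ = s * (ξ / s)
  have hsdvd : s ∣ ξ := by
    rcases Nat.eq_zero_or_pos ξ with h0ξ | _
    · rw [h0ξ]; exact dvd_zero _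
    · exact Nat.Coprime.mul_dvd_of_dvd_of_dvd
        (Nat.Coprime.pow _ _ (by norm_num : Nat.Coprime 2 3)) (Nat.ordProj_dvd ξ 2) (Nat.ordProj_dvd ξ 3)
  have hsc : (ξ : ℝ) = (s : ℝ) * ((ξ / s : ℕ) : ℝ) := by
    have : s * (ξ / s) = ξ := Nat.mul_div_cancel' hsdvd
    exact_mod_cast this.symm
  -- ∏_{q ∣ Nm} v_q ≤ ∏_{q ∣ N} v_q  (every factor ≥ 1 on N.primeFactors)
  haveI := isElliptic_freyCurve h0
  have hv1 : ∀ q ∈ N.primeFactors, 1 ≤ v q := by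
    intro q hq
    have hq' : q ∈ ((freyCurve a b).minimalDiscriminantNorm ℤ).primeFactors := by
      rw [← primeFactors_conductorNorm_eq (freyCurve a b), hN]; exact hq
    rw [← Nat.support_factorization] at hq'
    exact Nat.one_le_iff_ne_zero.mpr (Finsupp.mem_support_iff.mp hq')
  have hprodle : ∏ q ∈ Nm.primeFactors, v q ≤ ∏ q ∈ N.primeFactors, v q :=
    Finset.prod_le_prod_of_subset_of_one_le' hsub (fun q hq _ => hv1 q hq)
  have hprodleR : (∏ q ∈ Nm.primeFactors, ((v q : ℕ) : ℝ)) ≤ ((∏ q ∈ N.primeFactors, v q : ℕ) : ℝ) := by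
    rw [← Nat.cast_prod]; exact_mod_cast hprodle
  have hM : (0 : ℝ) ≤ ∏ q ∈ Nm.primeFactors, ((v q : ℕ) : ℝ) := by positivity
  have hc : (0 : ℝ) ≤ ((ξ / s : ℕ) : ℝ) := by positivity
  have hC₁0 : (0 : ℝ) ≤ max C₁ 0 := le_max_right _ _
  have hC₂0 : (0 : ℝ) ≤ max C₂ 0 := le_max_right _ _
  have hA'' : (s : ℝ) ≤ max C₁ 0 * (N : ℝ) ^ (ε / 2) * (d : ℝ) := by
    refine le_trans hA' ?_
    gcongr
    exact le_max_left _ _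
  have hB'' : ((ξ / s : ℕ) : ℝ) * ((∏ q ∈ N.primeFactors, v q : ℕ) : ℝ) * (d : ℝ) ≤
      max C₂ 0 * (N : ℝ) ^ (2 + ε / 2) := by
    refine le_trans hB' ?_
    gcongr
    exact le_max_left _ _
  have hNsplit : (N : ℝ) ^ (ε / 2) * (N : ℝ) ^ (2 + ε / 2) = (N : ℝ) ^ (2 + ε) := by
    rw [← Real.rpow_add hNpos]; ring_nf
  -- main chain, with the factor d carried and cancelled at the end
  have key : (ξ : ℝ) * (∏ q ∈ Nm.primeFactors, ((v q : ℕ) : ℝ)) * (d : ℝ) ≤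
      max C₁ 0 * max C₂ 0 * (N : ℝ) ^ (2 + ε) * (d : ℝ) := by
    calc (ξ : ℝ) * (∏ q ∈ Nm.primeFactors, ((v q : ℕ) : ℝ)) * (d : ℝ)
        = (s : ℝ) * ((((ξ / s : ℕ) : ℝ) * ∏ q ∈ Nm.primeFactors, ((v q : ℕ) : ℝ)) * (d : ℝ)) := by
          rw [hsc]; ring
      _ ≤ (max C₁ 0 * (N : ℝ) ^ (ε / 2) * (d : ℝ)) *
            ((((ξ / s : ℕ) : ℝ) * ((∏ q ∈ N.primeFactors, v q : ℕ) : ℝ)) * (d : ℝ)) := by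
          gcongr
      _ = max C₁ 0 * (N : ℝ) ^ (ε / 2) *
            ((((ξ / s : ℕ) : ℝ) * ((∏ q ∈ N.primeFactors, v q : ℕ) : ℝ) * (d : ℝ))) * (d : ℝ) := by ring
      _ ≤ max C₁ 0 * (N : ℝ) ^ (ε / 2) * (max C₂ 0 * (N : ℝ) ^ (2 + ε / 2)) * (d : ℝ) := by
          gcongr
      _ = max C₁ 0 * max C₂ 0 * (N : ℝ) ^ (2 + ε) * (d : ℝ) := by rw [← hNsplit]; ring
  exact le_of_mul_le_mul_right key hdpos

/-! ## §3 The slope-weakened forced-pair depth law -/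

/-- `WeakForcedPairDepthLaw θ` (`θ ≥ 1`): at every forced pair `(q, ℓ)`, `32 q ∣ ℓ − 1`, the quarantined congruence
number of `E_(−ℓ,ℓ−1)` has `v₂ ξ ≥ v₂(q−1)/θ − c`.  `θ = 1` is the tree's `ForcedPairDepthLaw`; for every `θ` the
composition `… → ¬EisensteinQuarantine` of p134266 goes through verbatim with the supply exponent `A ↦ θ·A`
(choose `ε < 1/(θ·A·…)`), so weakening the slope buys nothing unless a mechanism for SOME positive slope exists. [folklore] -/
def WeakForcedPairDepthLaw (θ : ℕ) : Prop :=
  ∃ c : ℕ, ∀ q ℓ : ℕ, q.Prime → ℓ.Prime → q ≠ 2 → 32 * q ∣ ℓ - 1 →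
    ∀ N : ℕ, (freyCurve (-(ℓ : ℤ)) ((ℓ - 1 : ℕ) : ℤ)).conductorNorm ℤ = N →
      2 ^ ((q - 1).factorization 2 / θ) ≤
        2 ^ c * ordProj[2] (brandtXi (N / ℓ) ℓ
          (fun n => (freyCurve (-(ℓ : ℤ)) ((ℓ - 1 : ℕ) : ℤ)).LFunction n))

/-- `θ = 1` recovers the tree's law. [folklore] -/
theorem weakForcedPairDepthLaw_one_iff : WeakForcedPairDepthLaw 1 ↔ ForcedPairDepthLaw := by
  simp [WeakForcedPairDepthLaw, ForcedPairDepthLaw]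

/-- Monotonicity in the slope: the law only gets weaker as `θ` grows. [folklore] -/
theorem weakForcedPairDepthLaw_mono {θ θ' : ℕ} (hθ : 1 ≤ θ) (h : θ ≤ θ') :
    WeakForcedPairDepthLaw θ → WeakForcedPairDepthLaw θ' := by
  rintro ⟨c, hc⟩
  refine ⟨c, fun q ℓ hq hℓ hq2 hdiv N hN => le_trans ?_ (hc q ℓ hq hℓ hq2 hdiv N hN)⟩
  apply Nat.pow_le_pow_right (by norm_num)
  exact Nat.div_le_div_left h (by omega)

/-! ## §4 Typed allowance candidates for the re-seam (instances of `D` in §2) -/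

/-- `ℓ`-adic residuacity depth of `a` modulo `m`: `v_ℓ([ (ℤ/m)ˣ-order quotient ])` =
`padicValNat ℓ ((m − 1) / ord_m a)`; for `m = p` prime this is the largest `j` with `a` an `ℓ^j`-th power residue
mod `p` (given `ℓ^j ∣ p − 1`).  `resDepth 2 p 2 = twoDepth p` of the tree (η₂ law); `resDepth 2 q p` is the gate `r_q(p)`. [folklore] -/
def resDepth (ℓ m a : ℕ) : ℕ := padicValNat ℓ ((m - 1) / orderOf (a : ZMod m))

theorem resDepth_two_eq_twoDepth (p : ℕ) : resDepth 2 p 2 = twoDepth p := rfl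

/-- The level-lowering content the crux already pays: `𝓛(a,b,N,Nm) = ∏_{q ∣ N, q ∤ Nm} v_q(Δ_min)`. [folklore] -/
def levelLoweringContent (a b : ℤ) (N Nm : ℕ) : ℕ :=
  ∏ q ∈ N.primeFactors \ Nm.primeFactors, ((freyCurve a b).minimalDiscriminantNorm ℤ).factorization q

/-- C″ as an allowance: `D_signBlind = 𝓛 · ∏_{q ∣ N odd} sixPart(q² − 1)` (cdisprove's `EisensteinQuarantineSignBlind` is
`QuarantineWith D_signBlind` up to bookkeeping). Census-consistent 54/54; NOT matched by an abc-implied core. [folklore] -/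
def D_signBlind (a b : ℤ) (N Nm : ℕ) : ℕ :=
  levelLoweringContent a b N Nm * ∏ q ∈ N.primeFactors.erase 2, (ordProj[2] (q ^ 2 - 1) * ordProj[3] (q ^ 2 - 1))

/-- C⁗ as an allowance (slack `B`): unquarantined odd primes pay their sign-blind index `sixPart(q²−1)` (gate ignored —
over-charging is safe on the A-side), quarantined primes pay the residuacity charge `2^{m₂(p)+B}·3^{m₃(p)+B}` capped by
`sixPart(p²−1)`.  Cards eta2 §(4)(ii) / forced-pair §Transfer; A-side consistent on 34–36/36 rows with `B ∈ [3,7]`; the matching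
`CoreWith (D_residuacity B)` is abc-implied iff the two-sided depth law holds. [folklore] -/
def D_residuacity (B : ℕ) (a b : ℤ) (N Nm : ℕ) : ℕ :=
  levelLoweringContent a b N Nm *
    (∏ q ∈ (N.primeFactors \ Nm.primeFactors).erase 2, (ordProj[2] (q ^ 2 - 1) * ordProj[3] (q ^ 2 - 1))) *
    ∏ p ∈ Nm.primeFactors, min (ordProj[2] (p ^ 2 - 1) * ordProj[3] (p ^ 2 - 1))
      (2 ^ (resDepth 2 p 2 + B) * 3 ^ (resDepth 3 p 3 + B))

/-- Both candidates are `≥ 1` on the crux's domain (so `xiStrongBound_of_with` applies): shown here for the factors that are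
products of `ordProj`s / powers; the `𝓛`-factor is `≥ 1` by `one_le_allowance`. [folklore] -/
theorem one_le_D_residuacity_of_domain {a b : ℤ} (h0 : a * b * (a + b) ≠ 0) {N : ℕ}
    (hN : (freyCurve a b).conductorNorm ℤ = N) (Nm B : ℕ) : 1 ≤ D_residuacity B a b N Nm := by
  unfold D_residuacity levelLoweringContent
  have h1 : 1 ≤ ∏ q ∈ N.primeFactors \ Nm.primeFactors,
      ((freyCurve a b).minimalDiscriminantNorm ℤ).factorization q := one_le_allowance h0 hN _
  have h2 : 1 ≤ ∏ q ∈ (N.primeFactors \ Nm.primeFactors).erase 2,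
      (ordProj[2] (q ^ 2 - 1) * ordProj[3] (q ^ 2 - 1)) :=
    Nat.one_le_iff_ne_zero.mpr (Finset.prod_ne_zero_iff.mpr fun q _ =>
      Nat.mul_ne_zero (Nat.ordProj_pos _ 2).ne' (Nat.ordProj_pos _ 3).ne')
  have h3 : 1 ≤ ∏ p ∈ Nm.primeFactors, min (ordProj[2] (p ^ 2 - 1) * ordProj[3] (p ^ 2 - 1))
      (2 ^ (resDepth 2 p 2 + B) * 3 ^ (resDepth 3 p 3 + B)) :=
    Nat.one_le_iff_ne_zero.mpr (Finset.prod_ne_zero_iff.mpr fun p _ => by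
      apply Nat.ne_of_gt
      refine lt_min ?_ ?_
      · exact Nat.mul_pos (Nat.ordProj_pos _ 2) (Nat.ordProj_pos _ 3)
      · positivity)
  calc 1 = 1 * 1 * 1 := by norm_num
    _ ≤ _ := Nat.mul_le_mul (Nat.mul_le_mul h1 h2) h3

end Summit.ABC.ABC.Cruxes.EisensteinQuarantine.Strategist
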